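import Literature.AlgebraicGeometry.Resolution.ValuationDefectProofs
import Literature.AlgebraicGeometry.Resolution.AbhyankarInvariants
import HarnessLib

/-!
# The generalized stability theorem over a trivially valued field: reduction (Kuhlmann 2010)

Topic: `Literature/AlgebraicGeometry/Resolution` (valued function fields). First layer of the
decomposition of the named fact `Kuhlmann2010Stability` (`ValuationDefect.lean`) = F.-V. Kuhlmann,
*Elimination of ramification I: The generalized stability theorem*, Trans. AMS 362 (2010)
5697–5727 = arXiv:1003.5678, **Thm. 1.1** ("Let `(F|K, v)` be a valued function field without
transcendence defect. If `(K, v)` is a defectless field, then `(F, v)` is a defectless field")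
over a TRIVIALLY valued ground field, along the printed proof. Over a trivially valued `k` the
source's argument runs: Cor. 2.6 (p. 5) — a valued function field `K/k` without transcendence
defect has a standard valuation transcendence basis `𝒯 = {x₁, …, x_r, y₁, …, y_s}` and `K` is
finite over `k(𝒯)` —; Thm. 1.1 for the valued rational function field `k(𝒯)` (whose valuation is
determined by the values of the `xᵢ` and the residues of the `yⱼ`, Lemma 2.5); and Cor. 2.16
(p. 7) — "Every finite extension of a defectless field is again a defectless field". All page
numbers are those of arXiv:1003.5678.

## Content

* `comapSubringHom`, `valueGroupHom`, `unitsValueGroupHom`, `residueFieldHom` — for an extension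
  `K → L` of valued fields (`K° = L° ∩ K`, i.e. `O.comap (algebraMap K L)` for `O = L°`): the
  local inclusion `K° → L°`, the order embedding `|K| → |L|` of value groups
  (`valueGroupHom_le_iff`, `valueGroupHom_injective`; its image on units is `|K^×| ⊆ |L^×|`,
  `range_unitsValueGroupHom`) and the embedding `K̃ → L̃` of residue fields (image `K̃ ⊆ L̃`,
  `fieldRange_residueFieldHom`). DEFINITIONS + API, [folklore].
* `ramificationIndex_tower`, `inertiaDegree_tower` — **`e` and `f` are multiplicative in towers**
  `K → L → M`: `e(M°/K) = e(L°/K) e(M°/L)`, `f(M°/K) = f(L°/K) f(M°/L)` (the "multiplicativity of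
  … ramification index and inertia degree" invoked for Lemma 2.13, p. 7). PROVED.
* `FundamentalInequality` — NAMED FACT: the fundamental inequality `n ≥ ∑_{i=1}^{g} eᵢ fᵢ` over ALL
  (finitely many) extensions of the valuation (§1, (1), p. 3, "cf. [En], [Z–S]"). The tree has the
  one-extension form `e f ≤ n` (`ramificationIndex_mul_inertiaDegree_le_finrank`); the
  simultaneous form needs the approximation theorem for incomparable valuation rings.
* `IsDefectlessField.of_finiteDimensional` — **Cor. 2.16** PROVED from `FundamentalInequality`:
  a finite extension `(L, L°)` of a defectless `(K, L° ∩ K)` is defectless (grouping the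
  extensions of `K°` to `M ⊇ L` by their restrictions to `L`, the tower laws turn
  `[M : K] = ∑ e f` into `∑_{O₁} e(O₁/K) f(O₁/K) (∑_{O'' | O₁} e(O''/L) f(O''/L)) ≤ [L : K][M : L]`,
  forcing equality at `O₁ = L°`).
* `Kuhlmann2010StabilityRational` — NAMED FACT: Thm. 1.1 for `F = k(x, y)` generated over the
  trivially valued `k` (defectless: "every trivially valued field is a defectless field", §1,
  p. 3 = `isDefectlessField_top`, `ValuationDefectProofs.lean`, which is why
  `Kuhlmann2010Stability` omits this hypothesis of Thm. 1.1) by a standard valuation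
  transcendence basis (non-zero `xᵢ` with
  `ℤ`-independent values, `yⱼ ∈ F°` with residues algebraically independent over `k`). Its
  printed proof is §§3–5 of the source (henselization, defect under tame extensions, composite
  valuations, Artin–Schreier/Kummer normal forms) and is the remaining frontier.
* `Kuhlmann2010Stability.of_parts : FundamentalInequality → Kuhlmann2010StabilityRational →
  Kuhlmann2010Stability` — PROVED assembly (Cor. 2.6 via `AbhyankarInvariants.lean` /
  `PrimeDivisors.lean` / `TranscendenceDefect.lean`; transport of independent values and
  residues to the subfield `k(𝒯)` by `unitsValueGroupHom`, `residueFieldAlgHom`; Cor. 2.16).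

## Sources

* F.-V. Kuhlmann, *Elimination of ramification I: The generalized stability theorem*, Trans.
  Amer. Math. Soc. 362 (2010) 5697–5727 = arXiv:1003.5678: §1 (p. 3: (1), defectless fields,
  "every trivially valued field is a defectless field"; p. 4: standard valuation transcendence
  bases), Thm. 1.1, Lemma 2.1, Lemma 2.5, Cor. 2.6 (pp. 5–6), Lemma 2.13, Cor. 2.16 (p. 7), §5
  (pp. 18–19: Lemma 5.1 and the reductions (R1)–(R4)).

## Rendering notes

* As in `ValuationDefect.lean`, an extension of valued fields is `[Algebra K L]` plus
  `O : ValuationSubring L`, the valuation ring of `K` being `O.comap (algebraMap K L)`; "the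
  extensions of `K°` to `L`" are the `O'` with `O'.comap (algebraMap K L) = K°`, and their
  finiteness is part of the statements (`IsDefectlessIn`, `FundamentalInequality`).
* `Kuhlmann2010StabilityRational` takes the trivially valued ground field as
  `[Algebra k O] [IsScalarTower k O K]` (`k ⊆ K°`), the generators as finite families
  `x : Fin r → K`, `y : Fin s → K°`, and "`F = k(𝒯)`" as `IntermediateField.adjoin k (x ∪ y) = ⊤`;
  by Lemma 2.5 (`algebraicIndependent_sumElim_of_valuation`) `𝒯` is then a transcendence basis
  and `(F|k, v)` is without transcendence defect, so this is an instance of Thm. 1.1, stated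
  without constructing the Gauss-type valuation on `k(𝒯)`.
-/

noncomputable section

open IsLocalRing Cardinal

namespace Literature.AlgebraicGeometry.Resolution

universe u

section Comap

variable (K : Type u) {L : Type u} [Field K] [Field L] [Algebra K L] (O : ValuationSubring L)

/-- The inclusion `K° = L° ∩ K → L°` of valuation rings for an extension `K → L` of valued
fields (`K° = O.comap (algebraMap K L)`, `O = L°`). [folklore] -/
def comapSubringHom : O.comap (algebraMap K L) →+* O :=
  (algebraMap K L).restrict (O.comap (algebraMap K L)) O fun _ hx => hx

/-- `K° → L°` is the restriction of `K → L`. [folklore] -/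
@[simp]
theorem coe_comapSubringHom_apply (x : O.comap (algebraMap K L)) :
    ((comapSubringHom K O x : O) : L) = algebraMap K L x := rfl

/-- `K° → L°` is a local homomorphism: an element of `K°` invertible in `L°` is invertible in
`K°`. [folklore] -/
instance isLocalHom_comapSubringHom : IsLocalHom (comapSubringHom K O) := by
  refine ⟨fun a ha => ?_⟩
  have ha0 : (a : K) ≠ 0 := by
    rintro h
    have : (comapSubringHom K O a : O) = 0 := Subtype.ext (by simp [h])
    exact not_isUnit_zero (this ▸ ha)
  have hinv : algebraMap K L (a : K)⁻¹ ∈ O := by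
    have h1 : O.valuation (algebraMap K L a) = 1 :=
      (O.valuation_eq_one_iff (comapSubringHom K O a)).mp ha
    refine (O.valuation_le_one_iff _).mp ?_
    rw [map_inv₀, map_inv₀, h1, inv_one]
  have hinv' : (a : K)⁻¹ ∈ O.comap (algebraMap K L) := hinv
  exact IsUnit.of_mul_eq_one (b := ⟨(a : K)⁻¹, hinv'⟩) (Subtype.ext (mul_inv_cancel₀ ha0))

/-- **Value groups along an extension.** The embedding `|K| → |L|` of value groups (with zero)
induced by `K → L`, `K° = L° ∩ K`: the class of `c ∈ K` modulo `(K°)ˣ` goes to the class of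
`c ∈ L` modulo `(L°)ˣ`. [folklore] -/
def valueGroupHom : (O.comap (algebraMap K L)).ValueGroup →*₀ O.ValueGroup where
  toFun := Quotient.map' (algebraMap K L) fun x y h => by
    obtain ⟨u, hu⟩ := h
    refine ⟨Units.map (comapSubringHom K O).toMonoidHom u, ?_⟩
    rw [← hu]
    simp only [Units.smul_def, Algebra.smul_def, map_mul]
    rfl
  map_zero' := by
    change Quotient.mk'' _ = Quotient.mk'' _
    rw [map_zero]
  map_one' := by
    change Quotient.mk'' _ = Quotient.mk'' _
    rw [map_one]
  map_mul' := by
    rintro ⟨a⟩ ⟨b⟩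
    change Quotient.mk'' _ = Quotient.mk'' _
    rw [map_mul]

/-- `|K| → |L|` is compatible with the valuations: `|c|_K ↦ |c|_L`. [folklore] -/
@[simp]
theorem valueGroupHom_valuation (x : K) :
    valueGroupHom K O ((O.comap (algebraMap K L)).valuation x) = O.valuation (algebraMap K L x) :=
  rfl

/-- `|K| → |L|` reflects and preserves the order. [folklore] -/
theorem valueGroupHom_le_iff (γ δ : (O.comap (algebraMap K L)).ValueGroup) :
    valueGroupHom K O γ ≤ valueGroupHom K O δ ↔ γ ≤ δ := by
  obtain ⟨x, rfl⟩ := (O.comap (algebraMap K L)).valuation_surjective γ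
  obtain ⟨y, rfl⟩ := (O.comap (algebraMap K L)).valuation_surjective δ
  simp only [valueGroupHom_valuation, ValuationSubring.valuation_le_iff]
  constructor
  · rintro ⟨a, ha⟩
    by_cases hy : y = 0
    · subst hy
      have hx : x = 0 := by
        rw [map_zero, mul_zero] at ha
        exact (map_eq_zero (algebraMap K L)).mp ha.symm
      exact ⟨0, by simp [hx]⟩
    · have hmem : x / y ∈ O.comap (algebraMap K L) := by
        change algebraMap K L (x / y) ∈ O
        rw [map_div₀, ← ha, mul_div_cancel_right₀ _ ((map_ne_zero (algebraMap K L)).mpr hy)]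
        exact a.2
      exact ⟨⟨x / y, hmem⟩, div_mul_cancel₀ x hy⟩
  · rintro ⟨a, ha⟩
    exact ⟨comapSubringHom K O a, by rw [← ha, map_mul]; rfl⟩

/-- `|K| → |L|` is injective. [folklore] -/
theorem valueGroupHom_injective : Function.Injective (valueGroupHom K O) := fun γ δ h =>
  le_antisymm ((valueGroupHom_le_iff K O γ δ).mp h.le) ((valueGroupHom_le_iff K O δ γ).mp h.ge)

/-- `|K^×| → |L^×|` on units. [folklore] -/
def unitsValueGroupHom :
    ((O.comap (algebraMap K L)).ValueGroup)ˣ →* (O.ValueGroup)ˣ :=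
  Units.map (valueGroupHom K O).toMonoidHom

/-- `|K^×| → |L^×|` is injective. [folklore] -/
theorem unitsValueGroupHom_injective : Function.Injective (unitsValueGroupHom K O) := by
  intro a b h
  exact Units.ext (valueGroupHom_injective K O (congrArg Units.val h))

/-- `|K^×| → |L^×|` on the value of a non-zero element. [folklore] -/
@[simp]
theorem unitsValueGroupHom_mk0 (x : K) (hx : (O.comap (algebraMap K L)).valuation x ≠ 0) :
    unitsValueGroupHom K O (Units.mk0 _ hx) =
      Units.mk0 (O.valuation (algebraMap K L x))
        ((Valuation.ne_zero_iff _).mpr ((map_ne_zero _).mpr ((Valuation.ne_zero_iff _).mp hx))) :=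
  Units.ext rfl

/-- The image of `|K^×| → |L^×|` is the subgroup `|K^×| ⊆ |L^×|` (`valueSubgroup`). [folklore] -/
theorem range_unitsValueGroupHom : (unitsValueGroupHom K O).range = valueSubgroup K O := by
  ext γ
  rw [mem_valueSubgroup_iff]
  constructor
  · rintro ⟨u, rfl⟩
    obtain ⟨c, hc⟩ := (O.comap (algebraMap K L)).valuation_surjective
      (u : (O.comap (algebraMap K L)).ValueGroup)
    have hc0 : c ≠ 0 := by
      rintro rfl
      rw [map_zero] at hc
      exact u.ne_zero hc.symm
    refine ⟨c, hc0, ?_⟩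
    change valueGroupHom K O (u : (O.comap (algebraMap K L)).ValueGroup) = _
    rw [← hc, valueGroupHom_valuation]
  · rintro ⟨c, hc0, hγ⟩
    have hc' : (O.comap (algebraMap K L)).valuation c ≠ 0 := (Valuation.ne_zero_iff _).mpr hc0
    refine ⟨Units.mk0 _ hc', Units.ext ?_⟩
    rw [hγ]
    rfl

end Comap

section ComapResidue

variable (K : Type u) {L : Type u} [Field K] [Field L] [Algebra K L] (O : ValuationSubring L)

/-- **Residue fields along an extension.** The embedding `K̃ → L̃` of residue fields induced by
the local homomorphism `K° → L°`. [folklore] -/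
def residueFieldHom : ResidueField (O.comap (algebraMap K L)) →+* ResidueField O :=
  ResidueField.map (comapSubringHom K O)

/-- `K̃ → L̃` is compatible with the residue maps. [folklore] -/
@[simp]
theorem residueFieldHom_residue (x : O.comap (algebraMap K L)) :
    residueFieldHom K O (residue _ x) = residue O (comapSubringHom K O x) :=
  ResidueField.map_residue _ _

/-- The image of `K̃ → L̃` is the subfield `K̃ ⊆ L̃` (`residueSubfield`). [folklore] -/
theorem fieldRange_residueFieldHom : (residueFieldHom K O).fieldRange = residueSubfield K O := by
  ext r
  rw [RingHom.mem_fieldRange, mem_residueSubfield_iff]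
  constructor
  · rintro ⟨y, rfl⟩
    obtain ⟨x, rfl⟩ := residue_surjective y
    exact ⟨x, x.2, by rw [residueFieldHom_residue]; rfl⟩
  · rintro ⟨c, h, rfl⟩
    exact ⟨residue _ ⟨c, h⟩, by rw [residueFieldHom_residue]; rfl⟩

/-- `K̃ → L̃` takes values in `K̃ ⊆ L̃`. [folklore] -/
theorem residueFieldHom_mem (y : ResidueField (O.comap (algebraMap K L))) :
    residueFieldHom K O y ∈ residueSubfield K O := by
  rw [← fieldRange_residueFieldHom]
  exact ⟨y, rfl⟩

end ComapResidue

section Tower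

variable (K L : Type u) {M : Type u} [Field K] [Field L] [Field M] [Algebra K L] [Algebra L M]
  [Algebra K M] [IsScalarTower K L M] (O : ValuationSubring M)

/-- In a tower `K → L → M`, `|K^×| ⊆ |L^×|` (inside `|L^×|`) maps onto `|K^×| ⊆ |M^×|`.
[folklore] -/
theorem map_valueSubgroup :
    (valueSubgroup K (O.comap (algebraMap L M))).map (unitsValueGroupHom L O) =
      valueSubgroup K O := by
  ext γ
  constructor
  · rintro ⟨δ, hδ, rfl⟩
    obtain ⟨c, hc0, hδc⟩ := (mem_valueSubgroup_iff K _ δ).mp hδ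
    refine (mem_valueSubgroup_iff K O _).mpr ⟨c, hc0, ?_⟩
    change valueGroupHom L O (δ : (O.comap (algebraMap L M)).ValueGroup) = _
    rw [hδc, valueGroupHom_valuation, ← IsScalarTower.algebraMap_apply]
  · intro hγ
    obtain ⟨c, hc0, hγc⟩ := (mem_valueSubgroup_iff K O γ).mp hγ
    have hc' : (O.comap (algebraMap L M)).valuation (algebraMap K L c) ≠ 0 :=
      (Valuation.ne_zero_iff _).mpr ((map_ne_zero _).mpr hc0)
    refine ⟨Units.mk0 _ hc', (mem_valueSubgroup_iff K _ _).mpr ⟨c, hc0, rfl⟩, Units.ext ?_⟩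
    rw [hγc, IsScalarTower.algebraMap_apply K L M]
    rfl

/-- **`e` is multiplicative in towers**: `e(M°/K) = e(L°/K) · e(M°/L)` for `K → L → M` and a
valuation ring `M°` of `M` inducing `L° = M° ∩ L`. [folklore] -/
theorem ramificationIndex_tower :
    ramificationIndex K O =
      ramificationIndex K (O.comap (algebraMap L M)) * ramificationIndex L O := by
  unfold ramificationIndex
  rw [← map_valueSubgroup K L O,
    (valueSubgroup K (O.comap (algebraMap L M))).index_map_of_injective
      (unitsValueGroupHom_injective L O),
    range_unitsValueGroupHom]

/-- In a tower `K → L → M`, `K̃ ⊆ L̃` maps onto `K̃ ⊆ M̃`. [folklore] -/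
theorem map_residueSubfield :
    (residueSubfield K (O.comap (algebraMap L M))).map (residueFieldHom L O) =
      residueSubfield K O := by
  ext r
  rw [Subfield.mem_map]
  constructor
  · rintro ⟨y, hy, rfl⟩
    obtain ⟨c, hc, rfl⟩ := (mem_residueSubfield_iff K _ y).mp hy
    rw [residueFieldHom_residue]
    refine (mem_residueSubfield_iff K O _).mpr ⟨c, ?_, ?_⟩
    · rw [IsScalarTower.algebraMap_apply K L M]; exact hc
    · exact congrArg (residue O) (Subtype.ext (IsScalarTower.algebraMap_apply K L M c))
  · intro hr
    obtain ⟨c, hc, rfl⟩ := (mem_residueSubfield_iff K O r).mp hr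
    have hc' : algebraMap K L c ∈ O.comap (algebraMap L M) := by
      change algebraMap L M (algebraMap K L c) ∈ O
      rw [← IsScalarTower.algebraMap_apply]; exact hc
    refine ⟨residue _ ⟨algebraMap K L c, hc'⟩,
      (mem_residueSubfield_iff K _ _).mpr ⟨c, hc', rfl⟩, ?_⟩
    rw [residueFieldHom_residue]
    exact congrArg (residue O) (Subtype.ext (IsScalarTower.algebraMap_apply K L M c).symm)

/-- `K̃ ⊆ L̃` inside `M̃`. [folklore] -/
theorem residueSubfield_le_residueSubfield : residueSubfield K O ≤ residueSubfield L O := by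
  intro r hr
  obtain ⟨c, hc, rfl⟩ := (mem_residueSubfield_iff K O r).mp hr
  have hc' : algebraMap L M (algebraMap K L c) ∈ O := by
    rw [← IsScalarTower.algebraMap_apply]; exact hc
  refine (mem_residueSubfield_iff L O _).mpr ⟨algebraMap K L c, hc', ?_⟩
  exact congrArg (residue O) (Subtype.ext (IsScalarTower.algebraMap_apply K L M c).symm)

end Tower

section SubfieldRank

variable {F₁ F₂ : Type u} [Field F₁] [Field F₂]

/-- Degrees in a tower of subfields `A ≤ B ≤ F`. [folklore] -/
theorem finrank_mul_finrank_of_subfield_le {A B : Subfield F₂} (hle : A ≤ B) :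
    letI : Algebra A B := (Subfield.inclusion hle).toAlgebra
    Module.finrank A B * Module.finrank B F₂ = Module.finrank A F₂ := by
  letI : Algebra A B := (Subfield.inclusion hle).toAlgebra
  haveI : IsScalarTower A B F₂ := IsScalarTower.of_algebraMap_eq fun _ => rfl
  exact Module.finrank_mul_finrank A B F₂

/-- A field embedding `ψ : F₁ → F₂` identifies `[F₁ : S]` with `[ψ(F₁) : ψ(S)]`. [folklore] -/
theorem finrank_eq_finrank_of_map_eq (ψ : F₁ →+* F₂) (S : Subfield F₁) {A B : Subfield F₂}
    (hA : S.map ψ = A) (hB : ψ.fieldRange = B) (hle : A ≤ B) :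
    letI : Algebra A B := (Subfield.inclusion hle).toAlgebra
    Module.finrank S F₁ = Module.finrank A B := by
  letI : Algebra A B := (Subfield.inclusion hle).toAlgebra
  have hSA : ∀ y, y ∈ S → ψ y ∈ A := fun y hy => hA ▸ Subfield.mem_map.mpr ⟨y, hy, rfl⟩
  have hB' : ∀ y, ψ y ∈ B := fun y => hB ▸ ⟨y, rfl⟩
  have hi : Function.Bijective (ψ.restrict S A hSA) := by
    refine ⟨fun a b h => Subtype.ext (ψ.injective (congrArg Subtype.val h)), fun r => ?_⟩
    have hr : (r : F₂) ∈ S.map ψ := hA.symm ▸ r.2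
    obtain ⟨y, hy, hyr⟩ := Subfield.mem_map.mp hr
    exact ⟨⟨y, hy⟩, Subtype.ext hyr⟩
  have hj : Function.Bijective (ψ.codRestrict B hB') := by
    refine ⟨fun a b h => ψ.injective (congrArg Subtype.val h), fun r => ?_⟩
    have hr : (r : F₂) ∈ ψ.fieldRange := hB.symm ▸ r.2
    obtain ⟨y, hyr⟩ := hr
    exact ⟨y, Subtype.ext hyr⟩
  exact Algebra.finrank_eq_of_equiv_equiv (RingEquiv.ofBijective _ hi) (RingEquiv.ofBijective _ hj)
    (RingHom.ext fun y => Subtype.ext rfl)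

end SubfieldRank

section TowerF

variable (K L : Type u) {M : Type u} [Field K] [Field L] [Field M] [Algebra K L] [Algebra L M]
  [Algebra K M] [IsScalarTower K L M] (O : ValuationSubring M)

/-- **`f` is multiplicative in towers**: `f(M°/K) = f(L°/K) · f(M°/L)`. [folklore] -/
theorem inertiaDegree_tower :
    inertiaDegree K O = inertiaDegree K (O.comap (algebraMap L M)) * inertiaDegree L O := by
  have hle := residueSubfield_le_residueSubfield K L O
  unfold inertiaDegree
  rw [← finrank_mul_finrank_of_subfield_le hle,
    finrank_eq_finrank_of_map_eq (residueFieldHom L O)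
      (residueSubfield K (O.comap (algebraMap L M)))
      (map_residueSubfield K L O) (fieldRange_residueFieldHom L O) hle]

end TowerF

/-! ### The fundamental inequality `n ≥ ∑ eᵢ fᵢ` (named fact) -/

/-- NAMED FACT — **the fundamental inequality** (Kuhlmann 2010, §1, (1), p. 3: "Every finite
extension `L` of a valued field `(K, v)` satisfies the fundamental inequality (cf. [En], [Z–S]):
`n ≥ ∑_{i=1}^{g} eᵢ fᵢ` where `n = [L : K]` is the degree of the extension, `v₁, …, v_g` are the
distinct extensions of `v` from `K` to `L`, `eᵢ = (vᵢL : vK)` are the respective ramification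
indices and `fᵢ = [Lvᵢ : Kv]` are the respective inertia degrees"; [En] = O. Endler, *Valuation
theory* (1972), [Z–S] = Zariski–Samuel, *Commutative Algebra* II, Ch. VI). Rendering (as in
`IsDefectlessIn`): for `L/K` finite and a valuation ring `O = K°` of `K`, the valuation rings `O'`
of `L` with `O' ∩ K = O` are finitely many — there is a finite set consisting exactly of them —
and `∑_{O'} e(O'/K) f(O'/K) ≤ [L : K]`. The one-extension case `e f ≤ n` is PROVED
(`ramificationIndex_mul_inertiaDegree_le_finrank`); the simultaneous bound needs the
approximation theorem for finitely many incomparable valuation rings, not available in Mathlib.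
[cite: Kuhlmann2010, Section 1, (1) (p. 3 of arXiv:1003.5678)] -/
def FundamentalInequality : Prop :=
  ∀ (K L : Type u) [Field K] [Field L] [Algebra K L], FiniteDimensional K L →
    ∀ O : ValuationSubring K, ∃ s : Finset (ValuationSubring L),
      (∀ O' : ValuationSubring L, O' ∈ s ↔ O'.comap (algebraMap K L) = O) ∧
      ∑ O' ∈ s, ramificationIndex K O' * inertiaDegree K O' ≤ Module.finrank K L

/-! ### Finite extensions of defectless fields (Cor. 2.16, proved from (1)) -/

section Finite

variable {K L : Type u} [Field K] [Field L] [Algebra K L]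

/-- **Kuhlmann 2010, Cor. 2.16** ("Every finite extension of a defectless field is again a
defectless field"), in the precise form: if `(K, K°)` is a defectless field, `L/K` is finite and
`O' = L°` is a valuation ring of `L` with `O' ∩ K = K°`, then `(L, O')` is a defectless field.
PROVED from the fundamental inequality `FundamentalInequality` (the source derives it from
Cor. 2.15 — henselizations — and the multiplicativity of the defect, Lemma 2.13; here: for
`M/L` finite, grouping the extensions of `K°` to `M` by their restrictions `O₁` to `L` and using
`e(O''/K) = e(O₁/K) e(O''/L)`, `f(O''/K) = f(O₁/K) f(O''/L)` gives
`[M : K] = ∑_{O₁} e(O₁/K) f(O₁/K) ∑_{O'' | O₁} e(O''/L) f(O''/L) ≤ ∑_{O₁} e(O₁/K) f(O₁/K) [M : L]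
= [L : K][M : L]`, so equality holds termwise, in particular at `O₁ = O'`).
[cite: Kuhlmann2010, Cor. 2.16] -/
theorem IsDefectlessField.of_finiteDimensional (hFI : FundamentalInequality.{u})
    [FiniteDimensional K L] (O' : ValuationSubring L)
    (h : IsDefectlessField K (O'.comap (algebraMap K L))) : IsDefectlessField L O' := by
  classical
  intro M _ _ hfin
  haveI := hfin
  letI : Algebra K M := ((algebraMap L M).comp (algebraMap K L)).toAlgebra
  haveI : IsScalarTower K L M := IsScalarTower.of_algebraMap_eq fun _ => rfl
  haveI : FiniteDimensional K M := Module.Finite.trans L M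
  -- `K°` is defectless in `M` and in `L`
  obtain ⟨sM, hsM, hsumM⟩ := h M inferInstance
  obtain ⟨sL, hsL, hsumL⟩ := h L inferInstance
  -- the fundamental inequality for `M/L` at every valuation ring of `L`
  choose t ht hle using fun O₁ : ValuationSubring L => hFI L M inferInstance O₁
  have hKM : ∀ O'' : ValuationSubring M, O''.comap (algebraMap K M) =
      (O''.comap (algebraMap L M)).comap (algebraMap K L) := fun O'' => by
    rw [ValuationSubring.comap_comap, ← IsScalarTower.algebraMap_eq K L M]
  have hmaps : ∀ O'' ∈ sM, O''.comap (algebraMap L M) ∈ sL := fun O'' hO'' => by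
    rw [hsL, ← hKM]
    exact (hsM O'').mp hO''
  have hfib : ∀ O₁ ∈ sL,
      sM.filter (fun O'' => O''.comap (algebraMap L M) = O₁) = t O₁ := fun O₁ hO₁ => by
    ext O''
    rw [Finset.mem_filter, hsM, ht, hKM]
    constructor
    · exact fun h => h.2
    · intro hc
      exact ⟨by rw [hc]; exact (hsL O₁).mp hO₁, hc⟩
  -- `[M : K] = ∑_{O₁} e f (O₁/K) · ∑_{O'' | O₁} e f (O''/L)`
  have hkey : Module.finrank K M = ∑ O₁ ∈ sL, ramificationIndex K O₁ * inertiaDegree K O₁ *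
      ∑ O'' ∈ t O₁, ramificationIndex L O'' * inertiaDegree L O'' := by
    rw [← hsumM, ← Finset.sum_fiberwise_of_maps_to hmaps]
    refine Finset.sum_congr rfl fun O₁ hO₁ => ?_
    rw [hfib O₁ hO₁, Finset.mul_sum]
    refine Finset.sum_congr rfl fun O'' hO'' => ?_
    have hc : O''.comap (algebraMap L M) = O₁ := (ht O₁ O'').mp hO''
    rw [ramificationIndex_tower K L O'', inertiaDegree_tower K L O'', hc]
    ring
  have hbound : ∀ O₁ ∈ sL, ramificationIndex K O₁ * inertiaDegree K O₁ *
      ∑ O'' ∈ t O₁, ramificationIndex L O'' * inertiaDegree L O'' ≤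
      ramificationIndex K O₁ * inertiaDegree K O₁ * Module.finrank L M :=
    fun O₁ _ => Nat.mul_le_mul_left _ (hle O₁)
  have htotal : ∑ O₁ ∈ sL, ramificationIndex K O₁ * inertiaDegree K O₁ *
      ∑ O'' ∈ t O₁, ramificationIndex L O'' * inertiaDegree L O'' =
      ∑ O₁ ∈ sL, ramificationIndex K O₁ * inertiaDegree K O₁ * Module.finrank L M := by
    refine le_antisymm (Finset.sum_le_sum hbound) (le_of_eq ?_)
    rw [← Finset.sum_mul, hsumL, Module.finrank_mul_finrank K L M, hkey]
  have hO' : O' ∈ sL := (hsL O').mpr rfl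
  have hterm := (Finset.sum_eq_sum_iff_of_le hbound).mp htotal O' hO'
  have hpos : 0 < ramificationIndex K O' * inertiaDegree K O' :=
    Nat.mul_pos (one_le_ramificationIndex_and_inertiaDegree K O').1
      (one_le_ramificationIndex_and_inertiaDegree K O').2
  exact ⟨t O', ht O', Nat.eq_of_mul_eq_mul_left hpos hterm⟩

end Finite

/-! ### The generalized stability theorem for valued rational function fields (named fact) -/

/-- NAMED FACT — **Kuhlmann 2010, Thm. 1.1 for a valued rational function field over a
trivially valued field.** Thm. 1.1: "Let `(F|K, v)` be a valued function field without
transcendence defect. If `(K, v)` is a defectless field, then `(F, v)` is a defectless field";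
§1, p. 3: "Note that every trivially valued field is a defectless field"; §1.2, p. 4: "A standard
valuation transcendence basis of an extension `(F|K, v)` of valued fields is a transcendence
basis `𝒯 = {xᵢ, yⱼ | i ∈ I, j ∈ J}` where the values `vxᵢ`, `i ∈ I`, are rationally independent
values in `vF` modulo `vK`, and the residues `ȳⱼ`, `j ∈ J`, are algebraically independent over
`K̄`"; Lemma 2.5 (p. 5): such `xᵢ, yⱼ` "are algebraically independent over `K`" and "the
valuation `v` on `K(xᵢ, yⱼ | i ∈ I, j ∈ J)` is uniquely determined by its restriction to `K`,
the values `vxᵢ` and the residues `yⱼv`". Vendored instance: `K = k` TRIVIALLY valued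
(`k ⊆ F°`; defectless by p. 3 — `isDefectlessField_top`, `ValuationDefectProofs.lean`) and
`F = k(x₁, …, x_r, y₁, …, y_s)` GENERATED over `k` by non-zero `xᵢ` with `ℤ`-independent values
in `|F^×|` and `yⱼ ∈ F°` with residues algebraically independent over `k`; then `{x, y}` is a
standard valuation transcendence basis of `F/k` (`algebraicIndependent_sumElim_of_valuation`) and
`tr.deg = r + s ≤ rr + res.tr.deg ≤ tr.deg` (`ratRank_add_residueTrdeg_le_trdeg`), i.e.
`(F|k, v)` is a valued function field without transcendence defect, so Thm. 1.1 says that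
`(F, F°)` is a defectless field (`IsDefectlessField`). This is the case of Thm. 1.1 to which the
theorem over a trivially valued ground field reduces by Cor. 2.6 and Cor. 2.16
(`Kuhlmann2010Stability.of_parts`); its printed proof is §§3–5 of the source (Lemma 5.1:
induction on the transcendence degree through NON-trivially valued intermediate fields;
(R1)–(R4): henselization, Thm. 2.14; defect under tame extensions, Prop. 2.18; composite
valuations, Lemmas 2.8, 2.17; Artin–Schreier and Kummer normal forms over henselized inertially
generated function fields, Prop. 4.1, Cor. 4.2; Prop. 3.1; Lemma 5.5), not available in Mathlib.
Users take `(h : Kuhlmann2010StabilityRational)`. [cite: Kuhlmann2010, Thm. 1.1] -/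
def Kuhlmann2010StabilityRational : Prop :=
  ∀ (k K : Type u) [Field k] [Field K] [Algebra k K] (O : ValuationSubring K)
    [Algebra k O] [IsScalarTower k O K] (r s : ℕ) (x : Fin r → K) (y : Fin s → O)
    (hx0 : ∀ i, x i ≠ 0),
    LinearIndependent ℤ (fun i =>
      Additive.ofMul (Units.mk0 (O.valuation (x i)) (valuation_ne_zero_of_ne_zero O (hx0 i)))) →
    AlgebraicIndependent k (fun j => residue O (y j)) →
    IntermediateField.adjoin k (Set.range x ∪ Set.range fun j => (y j : K)) = ⊤ →
    IsDefectlessField K O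

/-! ### Assembly: Thm. 1.1 over a trivially valued ground field from (1) and the rational case -/

section Assembly

variable {k K : Type u} [Field k] [Field K] [Algebra k K]

/-- Residues along `K₀ ⊆ K`: the residue field embedding `K̃₀ → K̃` is a `k`-algebra map for a
common trivially valued ground field `k ⊆ K₀°`. [folklore] -/
def residueFieldAlgHom (K₀ : IntermediateField k K) (O : ValuationSubring K)
    [Algebra k O] [IsScalarTower k O K]
    [Algebra k (O.comap (algebraMap K₀ K))] [IsScalarTower k (O.comap (algebraMap K₀ K)) K₀] :
    ResidueField (O.comap (algebraMap K₀ K)) →ₐ[k] ResidueField O :=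
  { residueFieldHom K₀ O with
    commutes' := fun c => by
      change residueFieldHom K₀ O (residue _ (algebraMap k _ c)) = residue O (algebraMap k O c)
      rw [residueFieldHom_residue]
      congr 1
      apply Subtype.ext
      have h1 : algebraMap (O.comap (algebraMap K₀ K)) K₀
          (algebraMap k (O.comap (algebraMap K₀ K)) c) = algebraMap k K₀ c :=
        (IsScalarTower.algebraMap_apply k (O.comap (algebraMap K₀ K)) K₀ c).symm
      change algebraMap K₀ K (algebraMap (O.comap (algebraMap K₀ K)) K₀
        (algebraMap k (O.comap (algebraMap K₀ K)) c)) = algebraMap O K (algebraMap k O c)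
      rw [h1, ← IsScalarTower.algebraMap_apply k O K, ← IsScalarTower.algebraMap_apply k K₀ K] }

/-- **Kuhlmann 2010, Thm. 1.1 over a trivially valued ground field, from its parts.** PROVED
reduction of the named fact `Kuhlmann2010Stability` (`ValuationDefect.lean`) to the fundamental
inequality (1) (`FundamentalInequality`) and the rational case (`Kuhlmann2010StabilityRational`),
following the source: by Cor. 2.6 (p. 5: "Take a valued function field `(F|K, v)` without
transcendence defect and set `r = rr vF/vK` and `s = trdeg F̄|K̄`. Choose elements `x₁, …, x_r,
y₁, …, y_s ∈ F` such that the values `vx₁, …, vx_r` are rationally independent over `vK` and the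
residues `ȳ₁, …, ȳ_s` are algebraically independent over `K̄`. Then `𝒯 = {x₁, …, x_r, y₁, …,
y_s}` is a standard valuation transcendence basis … It follows that the extension `F|K(𝒯)` is
finite") — here `exists_linearIndependent_valuation_of_ratRank_eq`,
`exists_algebraicIndependent_residue_of_residueTrdeg_eq`, `transcendenceDefect_eq_zero_iff`,
`isTranscendenceBasis_of_lift_trdeg_le_of_finite`,
`finiteDimensional_adjoin_of_isTranscendenceBasis` —, the valued subfield `(k(𝒯), K° ∩ k(𝒯))`
is a defectless field by the rational case (its generators keep independent values and
residues: `unitsValueGroupHom`, `residueFieldAlgHom`), and then `(K, K°)` is a defectless field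
by Cor. 2.16 (`IsDefectlessField.of_finiteDimensional`, proved from (1)).
[cite: Kuhlmann2010, Thm. 1.1, Cor. 2.6, Cor. 2.16] -/
theorem Kuhlmann2010Stability.of_parts (hFI : FundamentalInequality.{u})
    (hR : Kuhlmann2010StabilityRational.{u}) : Kuhlmann2010Stability.{u} := by
  intro k K _ _ _ hfg O hk hD
  classical
  letI := algebraOfMem k O hk
  haveI := isScalarTower_algebraOfMem k O hk
  -- Cor. 2.6: a standard valuation transcendence basis `(x, y)` of `K/k`
  have hN : Algebra.trdeg k K < ℵ₀ := trdeg_lt_aleph0_of_fg hfg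
  obtain ⟨N, hNn⟩ := Cardinal.lt_aleph0.mp hN
  obtain ⟨E, hE⟩ := Cardinal.lt_aleph0.mp (ratRank_lt_aleph0 O hk hN)
  obtain ⟨F, hF⟩ := Cardinal.lt_aleph0.mp (residueTrdeg_lt_aleph0 O hk hN)
  have hsum : E + F = N := by
    have h := (transcendenceDefect_eq_zero_iff O hk hN).mp hD
    rw [hE, hF, hNn] at h
    exact_mod_cast h
  obtain ⟨y, hy⟩ := exists_algebraicIndependent_residue_of_residueTrdeg_eq O hk F hF
  obtain ⟨x, hx0, hx⟩ := exists_linearIndependent_valuation_of_ratRank_eq O E hE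
  have hBind : AlgebraicIndependent k (Sum.elim x fun i => (y i : K)) :=
    algebraicIndependent_sumElim_of_valuation O y hy x (injective_valuation_prod_pow O x hx0 hx)
  have hcard : Cardinal.lift.{0} (Algebra.trdeg k K) ≤ Cardinal.lift.{u} #(Fin E ⊕ Fin F) := by
    rw [hNn]
    simp only [Cardinal.mk_sum, Cardinal.mk_fin, Cardinal.lift_natCast, Cardinal.lift_add]
    exact_mod_cast hsum.ge
  have hB : IsTranscendenceBasis k (Sum.elim x fun i => (y i : K)) :=
    hBind.isTranscendenceBasis_of_lift_trdeg_le_of_finite hcard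
  haveI := finiteDimensional_adjoin_of_isTranscendenceBasis hfg _ hB
  -- the valued subfield `K₀ = k(x, y)`, `K₀° = K° ∩ K₀`
  set K₀ : IntermediateField k K :=
    IntermediateField.adjoin k (Set.range (Sum.elim x fun i => (y i : K))) with hK₀
  let O₀ : ValuationSubring K₀ := O.comap (algebraMap K₀ K)
  have hk₀ : ∀ c : k, algebraMap k K₀ c ∈ O₀ := fun c => by
    change algebraMap K₀ K (algebraMap k K₀ c) ∈ O
    rw [← IsScalarTower.algebraMap_apply]
    exact hk c
  letI : Algebra k O₀ := algebraOfMem k O₀ hk₀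
  haveI : IsScalarTower k O₀ K₀ := isScalarTower_algebraOfMem k O₀ hk₀
  have hxmem : ∀ i, x i ∈ K₀ := fun i => IntermediateField.subset_adjoin _ _ ⟨Sum.inl i, rfl⟩
  have hymem : ∀ j, (y j : K) ∈ K₀ := fun j =>
    IntermediateField.subset_adjoin _ _ ⟨Sum.inr j, rfl⟩
  let x₀ : Fin E → K₀ := fun i => ⟨x i, hxmem i⟩
  let y₀ : Fin F → O₀ := fun j => ⟨⟨(y j : K), hymem j⟩, (y j).2⟩
  have hx₀0 : ∀ i, x₀ i ≠ 0 := fun i h => hx0 i (congrArg Subtype.val h)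
  -- values of the `xᵢ` stay `ℤ`-independent in `|K₀^×| ⊆ |K^×|`
  have hx₀ : LinearIndependent ℤ fun i => Additive.ofMul
      (Units.mk0 (O₀.valuation (x₀ i)) (valuation_ne_zero_of_ne_zero O₀ (hx₀0 i))) := by
    refine LinearIndependent.of_comp
      (MonoidHom.toAdditive (unitsValueGroupHom K₀ O)).toIntLinearMap ?_
    have hcomp : (⇑(MonoidHom.toAdditive (unitsValueGroupHom K₀ O)).toIntLinearMap ∘ fun i =>
        Additive.ofMul (Units.mk0 (O₀.valuation (x₀ i))
          (valuation_ne_zero_of_ne_zero O₀ (hx₀0 i)))) = fun j =>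
        Additive.ofMul (Units.mk0 (O.valuation (x j))
          (valuation_ne_zero_of_ne_zero O (hx0 j))) := by
      funext i
      have hu : unitsValueGroupHom K₀ O
          (Units.mk0 (O₀.valuation (x₀ i)) (valuation_ne_zero_of_ne_zero O₀ (hx₀0 i))) =
          Units.mk0 (O.valuation (x i)) (valuation_ne_zero_of_ne_zero O (hx0 i)) := Units.ext rfl
      change Additive.ofMul (unitsValueGroupHom K₀ O
        (Units.mk0 (O₀.valuation (x₀ i)) (valuation_ne_zero_of_ne_zero O₀ (hx₀0 i)))) =
        Additive.ofMul (Units.mk0 (O.valuation (x i)) (valuation_ne_zero_of_ne_zero O (hx0 i)))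
      rw [hu]
    rw [hcomp]
    exact hx
  -- residues of the `yⱼ` stay algebraically independent over `k`
  have hy₀ : AlgebraicIndependent k fun j => residue O₀ (y₀ j) := by
    refine AlgebraicIndependent.of_comp (residueFieldAlgHom K₀ O) ?_
    convert hy using 1
    funext j
    change residueFieldHom K₀ O (residue O₀ (y₀ j)) = residue O (y j)
    rw [residueFieldHom_residue]
    rfl
  -- `K₀` is generated over `k` by `x, y`
  have hgen : IntermediateField.adjoin k (Set.range x₀ ∪ Set.range fun j => (y₀ j : K₀)) = ⊤ := by
    apply IntermediateField.lift_injective K₀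
    rw [IntermediateField.lift_adjoin, IntermediateField.lift_top, Set.image_union,
      ← Set.range_comp, ← Set.range_comp]
    have h1 : (Subtype.val ∘ x₀) = x := funext fun i => rfl
    have h2 : (Subtype.val ∘ fun j => (y₀ j : K₀)) = fun j => (y j : K) := funext fun j => rfl
    rw [h1, h2, ← Set.Sum.elim_range]
  have h₀ : IsDefectlessField K₀ O₀ := hR k K₀ O₀ E F x₀ y₀ hx₀0 hx₀ hy₀ hgen
  -- Cor. 2.16
  exact IsDefectlessField.of_finiteDimensional hFI O h₀

end Assembly

end Literature.AlgebraicGeometry.Resolution
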